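import Mathlib
import Summits.Ventures.PercRepro2.HCov
import Summits.Ventures.PercRepro2.RootEdgeBern
import Summits.Ventures.PercRepro2.HCovPlusQuartic
import Summits.Ventures.PercRepro2.QuarticRootCross
import Summits.Ventures.PercRepro2.QuarticRootCrossOL
import Summits.Ventures.PercRepro2.QuarticRootSlack
import Summits.Ventures.PercRepro2.QuarticRootSlackSign

/-!
# THE ROOT-EDGE FACE OF THE QUARTIC IS FREE WHEREVER ITS TWO CROSS QUANTITIES ARE NONNEGATIVE
(blind cell PercRepro2, p5 g18; `proofs/P5-OEDGE.md` §24 addendum 2)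

At a root edge `e = {a₁, a₃}` every term of `H2 = Q₀·B2 + Q₁·B1 + c·slackBm` except the cross term
is a theorem-nonnegative quantity given (HCOV) at the closed pin (`B1_nonneg_root`, `B2_nonneg_root`,
`slackBm_nonneg_root`), and every term of `H1 = Q₀·B1 + Q₁·Gc₀ + covU₀·slackBm + c·slackB₀` except
the two cross products likewise (`slackB_nonneg`). Hence

* **`H2_nonneg_root_of_covUm_nonneg`**: `0 ≤ c` and (HCOV) at the closed pin give `0 ≤ H2`;
* **`H1_nonneg_root_of_nonneg`**: `0 ≤ c`, `0 ≤ covU₀` and (HCOV) at the closed pin give `0 ≤ H1`;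
* **`HCovPlus_of_update_zero_root_of_nonneg`**: (HCOV⁺) and (HCOV) at the closed pin, `0 ≤ c` and
  `0 ≤ covU₀` give (HCOV⁺) at `p`.

So the root-edge face of `JointGood` is open ONLY on the instances with `c < 0` (0.08 % of the
root-edge lines of kit j284197: 5,143 / 6,151,183) or `covU₀ < 0` (the cell's NEG instances), where
`c = D₀·P₀(PD, o ↔ a₃) + δ'_oL − δ_oH` (`QuarticRootCross.covUm_root_decomp`, `PDoL_mul_T'_le`) and
`covU₀ = (δ'_oL + δ'_oH^T) − (δ_oH + δ_oL^T)`; the crude bound `c ≥ −δ_oH` does not close the face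
there (the conditional reductions (C2) / (D3) are false in general, §24 addendum 2).
-/

namespace Summit.Ventures.PercRepro2

open UnionCluster CovForm CovForm.EdgeLine CovForm.RootEdge PendantA3 CPolarSubPlus HCovPlusQuartic

namespace QuarticRootCross

section Free

variable {V : Type*} {E : Type*} [Fintype V] [DecidableEq V] [Fintype E] [DecidableEq E]
  {R : Type*} [Field R] [LinearOrder R] [IsStrictOrderedRing R]

variable {ends : E → Sym2 V} {e : E} {a₁ a₃ : V}

/-- `slackB ≥ 0` at every weight vector (`PendantA3.slack_nonneg` read on `slackB`). -/
lemma slackB_nonneg' (p : E → R) (hp : IsProbVec p) (ends : E → Sym2 V) (a₁ a₂ a₃ b : V) :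
    0 ≤ slackB p ends a₁ a₂ a₃ b := by
  rw [slackB_eq]
  unfold Qb
  exact PendantA3.slack_nonneg p hp ends a₁ a₂ a₃ b

/-- **`0 ≤ H2` at a root edge wherever the cross term is nonnegative** (given (HCOV) at the closed pin). -/
theorem H2_nonneg_root_of_covUm_nonneg (p : E → R) (hp : IsProbVec p) (hends : ends e = s(a₁, a₃))
    (o a₂ b : V) (h₀ : HCov (Function.update p e 0) ends o a₁ a₂ a₃ b)
    (hc : 0 ≤ covUm p ends o a₁ a₂ a₃ e) : 0 ≤ H2 p ends o a₁ a₂ a₃ b e := by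
  have hp₀ : IsProbVec (Function.update p e 0) := hp.update e le_rfl zero_le_one
  have hp₁ : IsProbVec (Function.update p e 1) := hp.update e zero_le_one le_rfl
  rw [H2_eq_root p hends o a₂ b, ← covUm_eq_root p hends o a₂]
  have hB1 := B1_nonneg_root p hp hends o a₂ b h₀
  have hB2 := B2_nonneg_root p hp hends o a₂ b
  have hsm := slackBm_nonneg_root p hp hends a₂ b
  have hQ0 := prob_nonneg hp₀ (avoidAll ends a₂ {a₁})
  have hQ1 := prob_nonneg hp₁ (avoidAll ends a₂ {a₁})
  have := mul_nonneg hQ0 hB2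
  have := mul_nonneg hQ1 hB1
  have := mul_nonneg hc hsm
  linarith

/-- **`0 ≤ H1` at a root edge wherever both cross quantities are nonnegative** (given (HCOV) at the
closed pin). -/
theorem H1_nonneg_root_of_nonneg (p : E → R) (hp : IsProbVec p) (hends : ends e = s(a₁, a₃))
    (o a₂ b : V) (h₀ : HCov (Function.update p e 0) ends o a₁ a₂ a₃ b)
    (hc : 0 ≤ covUm p ends o a₁ a₂ a₃ e)
    (hcov : 0 ≤ covU (Function.update p e 0) ends o a₁ a₂ a₃) : 0 ≤ H1 p ends o a₁ a₂ a₃ b e := by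
  have hp₀ : IsProbVec (Function.update p e 0) := hp.update e le_rfl zero_le_one
  have hp₁ : IsProbVec (Function.update p e 1) := hp.update e zero_le_one le_rfl
  rw [H1_eq_root p hends o a₂ b, ← covUm_eq_root p hends o a₂]
  have hB1 := B1_nonneg_root p hp hends o a₂ b h₀
  have hsm := slackBm_nonneg_root p hp hends a₂ b
  have hsl := slackB_nonneg' (Function.update p e 0) hp₀ ends a₁ a₂ a₃ b
  have hQ0 := prob_nonneg hp₀ (avoidAll ends a₂ {a₁})
  have hQ1 := prob_nonneg hp₁ (avoidAll ends a₂ {a₁})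
  have hG : 0 ≤ Gc (Function.update p e 0) ends o a₁ a₂ a₃ b := h₀
  have := mul_nonneg hQ0 hB1
  have := mul_nonneg hQ1 hG
  have := mul_nonneg hcov hsm
  have := mul_nonneg hc hsl
  linarith

/-- **(HCOV⁺) across a root edge is free wherever `c ≥ 0` and `covU₀ ≥ 0`** (given (HCOV) and (HCOV⁺)
at the closed pin). -/
theorem HCovPlus_of_update_zero_root_of_nonneg (p : E → R) (hp : IsProbVec p)
    (hends : ends e = s(a₁, a₃)) (o a₂ b : V)
    (h₀ : HCov (Function.update p e 0) ends o a₁ a₂ a₃ b)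
    (h₀' : HCovPlus (Function.update p e 0) ends o a₁ a₂ a₃ b)
    (hc : 0 ≤ covUm p ends o a₁ a₂ a₃ e)
    (hcov : 0 ≤ covU (Function.update p e 0) ends o a₁ a₂ a₃) :
    HCovPlus p ends o a₁ a₂ a₃ b :=
  HCovPlus_of_update_zero_root p hp hends o a₂ b h₀'
    (H1_nonneg_root_of_nonneg p hp hends o a₂ b h₀ hc hcov)
    (H2_nonneg_root_of_covUm_nonneg p hp hends o a₂ b h₀ hc)

end Free

end QuarticRootCross

end Summit.Ventures.PercRepro2
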